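import Literature.MathematicalPhysics.QuantumFieldTheory.Balaban1983to89.B8SectEInLambdaWitnessRec
import Literature.MathematicalPhysics.QuantumFieldTheory.Balaban1983to89.B7Prop10InLambdaRec
import Literature.MathematicalPhysics.QuantumFieldTheory.Balaban1983to89.B8Thm4TruncationLocalRec
import Literature.MathematicalPhysics.QuantumFieldTheory.Balaban1983to89.B8Restr129InversionLocal

/-!
# `Balaban1983to89.B8Restr129InversionLocalRec` — RECORD TWIN of `B8Restr129InversionLocal` ([Balaban1985RegularSpaces] (1.29) p. 81 ∕ (1.78)–(1.79) p. 90 and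
# [Balaban1985Averaging] Prop. 10 (203)∕(204) p. 50, (166)–(167) p. 44: the INVERSION route (a″) of the Theorem-4 knit with tower-local hypotheses only)
# FOR THE SYMMETRISED CENTRED block averaging (0.4) of [Balaban1987RG1]

statement-level skeleton of published theorems with citation tags; proofs where landed; nothing here is a claim about the Yang–Mills mass gap

T. Bałaban, *Spaces of regular gauge field configurations on a lattice and gauge fixing conditions*, Commun. Math. Phys. **99** (1985) 75–102
`[Balaban1985RegularSpaces]` ("[6]"): (1.29) p. 81, (1.74)–(1.79) pp. 89–90, (1.112) p. 95, p. 94; T. Bałaban, *Averaging operations for lattice gauge theories*, Commun.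
Math. Phys. **98** (1985) 17–51 `[Balaban1985Averaging]` ("[3]"): (79)–(80) p. 30, (166)–(167) p. 44, (176)–(178) p. 45, Prop. 10 (203)–(207) p. 50; T. Bałaban,
*Renormalization group approach to lattice gauge field theories. I*, Commun. Math. Phys. **109** (1987) 249–301 `[Balaban1987RG1]` ("[I]"): (0.3)–(0.4) pp. 252–253.
STATUS: published, refereed.

CITATION HEADER (lean-in-tree rule).  Cell `pub-ymgap`, «N05-REC» stage 2 (director-ym №254∕№255∕№288), item R5-γ (Sect. E ∕ Prop 5 join for the record; dag-n05-c's remainder list,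
HANDOFF g26) — typed by the LEAD PEN dag-n05-e g39 (inventory `N05-REC-INVENTORY.md` §R5 row `B8Restr129InversionLocal`: A `restr129_mul_inv_of_cond179_local`, `witness_mul_of207`,
`uavg_inv_tower_of_witness`, `dom178_tower_of_witness`, `prop10_tower_of_witness`).  WHAT IS REPRODUCED = ✓ the engine module `B8Restr129InversionLocal` (seat
`pub-ymgap-dag-n04-b`) §1–§5 VERBATIM under the token map.  THEOREM NAMES = the engine's (namespace `…B8Restr129InversionLocalRec`; dag-n05-c's R5 convention).  TOKEN MAP:
`uavg ∕ utilG ∕ util178 ∕ avgIter ∕ InLambda ∕ Restr129 ∕ Cond179 ↦ uavgZ ∕ utilGZ ∕ util178Z ∕ avgIterZ ∕ InLambdaZ ∕ Restr129Z ∕ Cond179Z`; tower `B8Ineq130.tlo ∕ thi ↦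
B8Ineq130Rec.tlo ∕ thi` (CENTRED); regime `(hL : 2 ≤ L) ↦ (hLs : L = 2s+1) (hs1 : 1 ≤ s) (hd : 1 ≤ d)`, `C0 ↦ C0Z`, `2α₀ ≤ c₂′ ↦ 4α₀ ≤ c₂′`; record inputs
`B8Eq1112QuotientRec.uavgZ_inv`, `B8Ineq172ConcreteRec.uavgZ_congr_tower ∕ avgIterZ_agree_tower`, `B8Eq1115ConcreteRec.utilGZ_congr_tower`, `B8Thm4TruncationLocalRec.restr129Z_iff_uavgZ`,
`B8Eq178AveragesRec.utilGZ_eq_uavgZ_mul_inv ∕ util178Z_eq_utilGZ`, `B7Prop10GeneralRec.prop10_generalZ_of52 ∕ levels_of52Z`, `B7Prop10InLambdaRec.inLambdaZ_mul_of_prop10_generalZ`,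
`B8SectEInLambdaWitnessRec.witness_inv_of_unitaryZ`; structure-free `B7Eq214.ineq176_of_207 ∕ ineq177_of_207` REUSED BY NAME.  Kind «kernel-checked proof», theorems only; no `def`, no
`instance`, no `notation`, no existing module modified.  `--supports stmt-QuantumFields-20541` (K0⁷-keyed, COUNT-NEUTRAL).

## WHAT IS CERTIFIED HERE (kernel; axioms `propext` ∕ `Classical.choice` ∕ `Quot.sound`)
* §1 `uavg_inv_tower_of_witness` — `\overline{R₀u⁻¹}ᵐ(z) = (\overline{R₀u}ᵐ(z))⁻¹` on the centred tower from a `Λ_j`-witness.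
* §2 `restr129_inv_iff_of_witness`, `restr129_inv_of_witness` — (1.29) for `u₁⁻¹` from (1.29) for `u₁`, record structure.
* §3 `prop10_tower_of_witness`, `dom178_tower_of_witness` — Prop. 10 (203)∕(204) on the centred tower for any `u₁` with a `Λ_j`-witness.
* §4 `witness_mul_of207` — a `Λ_j`-witness for the product `e^{λ}·u₁`.
* §5 `restr129_mul_inv_of_cond179_local` — the Theorem-4 driver's (1.29)-clause by the LOCAL inversion route, record structure.

HONEST SCOPE: the engine's proofs verbatim under the token map; nothing of Bałaban's analysis newly proved; `HThm4Rec` UNDISCHARGED; caveat (C-S3-1) + addendum v4 stand; N05 [B8]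
DISCHARGED OF RECORD untouched; N05 ∕ N07 NOT discharged; COUNT of record unmoved · K numerically unchanged; one finite `𝕋⁴` programme at fixed `ε`, Bałaban AS PRINTED; nothing
continuum ∕ ℝ⁴ ∕ OS ∕ mass-gap ∕ Clay.  No `sorry`, no `def`.

[cite: Balaban1985RegularSpaces, (1.29) p.81, (1.74)–(1.79) pp.89–90, (1.112) p.95, p.94; Balaban1985Averaging, (79)–(80) p.30, (166)–(167) p.44, (176)–(178) p.45,
Proposition 10 (203)–(207) p.50; Balaban1987RG1, (0.3)–(0.4) pp.252–253]
-/

noncomputable section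

open NormedSpace Finset

namespace Literature.MathematicalPhysics.QuantumFieldTheory.Balaban1983to89.B8Restr129InversionLocalRec

open B7Prop1Explicit B7Prop2Explicit B7Prop3Flat B7Prop1Local
open MatrixLog (mlog exp_mlog)
open B7Eq170Flat (cj cj_apply val_Rc_eq_cj mlog_exp_of_le)
open B7Eq92Concrete (Rc mgauge)
open B7Prop9Flat (C5' SiteBd)
open B7Prop9General (CovBondBd)
open B7Prop10General (C6 C4G)
open B7Prop10Flat (one_le_C5 C4'_nonneg C5'_nonneg)
open B8Ineq130 (inBox_of_le)
open B8Ineq130Rec (tlo thi tlo_le_thi tlo_zero thi_zero)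
open B7Prop2Rec (AvgClosedZ C0Z avgClosedZ_unitaryUnits)
open BlockAveragingZd (avgIterZ)
open B7SectCDGaugeAveragesRec (uavgZ)
open B7SectEFLinearisationRec (InLambdaZ utilGZ)
open B7Prop10GeneralRec (prop10_generalZ_of52 levels_of52Z)
open B7Prop10InLambdaRec (inLambdaZ_mul_of_prop10_generalZ)
open B8Ineq172ConcreteRec (uavgZ_congr_tower)
open B8Eq1115ConcreteRec (utilGZ_congr_tower)
open B8Eq119TwistedAxialRec (InAxZ Restr129Z)
open B8Eq178AveragesRec (util178Z QnlZ Cond178Z Cond179Z utilGZ_eq_uavgZ_mul_inv util178Z_eq_utilGZ cond178Z_of_cond179Z)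
open B8Thm4TruncationLocalRec (restr129Z_iff_uavgZ)
open B8Eq1112QuotientRec (uavgZ_inv)
open B8SectEInLambdaWitnessRec (witness_inv_of_unitaryZ)

-- `Site` alone could resolve to the torus sites of `Setup.lean`; re-export the `ℤ^d` sites of `B7Prop1Explicit`.
export B7Prop1Explicit (Site)

variable {d : ℕ}

/-! ## §1 Inversion of the averages `\overline{R₀u}ᵐ` at the tower sites, from a `Λ_j`-witness -/

section Inv

variable {𝔸 : Type*} [NormedRing 𝔸] [NormedAlgebra ℂ 𝔸] [CompleteSpace 𝔸]
variable {L s j : ℕ} {y : Site d} {U₀ : Site d → Fin d → 𝔸ˣ} {u ut : Site d → 𝔸ˣ} {α₃ : ℝ}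

/-- **`\overline{R₀u⁻¹}ᵐ(z) = (\overline{R₀u}ᵐ(z))⁻¹` ON THE TOWER UNDER `y`, FROM A `Λ_j`-WITNESS** — the tower-local form of p05's
`B8Eq1112Quotient.uavg_inv` ([3] p. 44 «all operations needed to define R̄₀uᵏ are done always in a case where proper expressions are
small»): if `u` agrees on the sites of `Bʲ(y)` with a global `ũ ∈ Λ_j(π^*U₀, α₃)`, `α₃ < ½`, then at every level-`m` site `z` of `Bⁿ(y)`
(`n + m = j`) the average of `u⁻¹` is the inverse of the average of `u` — by the locality of (79)/(80) on the tower (`uavg_congr_tower`, for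
`u` and for `u⁻¹`) and the GLOBAL inversion for the witness (its (167) holds at every block of `ℤᵈ` w.r.t. `π^*U₀`).  No hypothesis off the
tower on `u` or `U₀`. [cite: Balaban1985Averaging, (79)–(80) p.30, (167) p.44; Balaban1985RegularSpaces, (1.74) p.89] -/
theorem uavg_inv_tower_of_witness (hLs : L = 2 * s + 1) (hL1 : 1 ≤ L) (hα₃ : 0 ≤ α₃) (hα₃' : α₃ < 1 / 2)
    (hW : InLambdaZ L (clampCfg (tlo L y j) (thi L y j) U₀) ut j α₃ (((L : ℝ) ^ j)⁻¹))
    (hu : ∀ x : Site d, tlo L y j ≤ x → x ≤ thi L y j → u x = ut x)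
    {m n : ℕ} (hmn : n + m = j) (z : Site d) (hz : tlo L y n ≤ z) (hz' : z ≤ thi L y n) :
    uavgZ L U₀ u⁻¹ m z = (uavgZ L U₀ u m z)⁻¹ := by
  have hLj : (0 : ℝ) < (L : ℝ) ^ j := by
    have : (1 : ℝ) ≤ L := by exact_mod_cast hL1
    positivity
  have h₀ : AgreeOn (tlo L y j) (thi L y j) U₀ (clampCfg (tlo L y j) (thi L y j) U₀) := (clampCfg_agree U₀).symm
  have huinv : ∀ x : Site d, tlo L y j ≤ x → x ≤ thi L y j → u⁻¹ x = ut⁻¹ x := fun x hx hx' => by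
    rw [Pi.inv_apply, Pi.inv_apply, hu x hx hx']
  have hs : α₃ * (L : ℝ) ^ j * ((L : ℝ) ^ j)⁻¹ < 1 / 2 := by
    rw [mul_assoc, mul_inv_cancel₀ hLj.ne', mul_one]; exact hα₃'
  have hglob := uavgZ_inv hW.2 hL1 (by positivity) hα₃ hs m (by omega)
  rw [uavgZ_congr_tower hLs h₀ huinv m n hmn z hz hz', uavgZ_congr_tower hLs h₀ hu m n hmn z hz hz', hglob, Pi.inv_apply]

end Inv

/-! ## §2 (1.29) for `u₁⁻¹` from (1.29) for `u₁`, witnesses at the constraint sites -/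

section Restr

variable {𝔸 : Type*} [NormedRing 𝔸] [NormedAlgebra ℂ 𝔸] [CompleteSpace 𝔸]
variable {L s k : ℕ} {Λ : ℕ → Set (Site d)} {U₀ : Site d → Fin d → 𝔸ˣ} {u₁ : Site d → 𝔸ˣ} {α₃ : ℝ}

/-- **(1.29) AT `k` LEVELS FOR `u⁻¹` IFF FOR `u`, TOWER-LOCAL FORM** (this seat's g2 `B8Restr129Inversion.restr129_inv_iff` without the global
(167)): given a `Λ_j`-witness for `u` at every `(j, y ∈ Λ_j)` (`α₃ < ½`), `\overline{R₀u⁻¹}ʲ(y) = (\overline{R₀u}ʲ(y))⁻¹` at each constraint site,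
so one is `1` iff the other is. [cite: Balaban1985RegularSpaces, (1.29) p.81; Balaban1985Averaging, (79)–(80) p.30, (167) p.44] -/
theorem restr129_inv_iff_of_witness (hLs : L = 2 * s + 1) (hL1 : 1 ≤ L) (hα₃ : 0 ≤ α₃) (hα₃' : α₃ < 1 / 2)
    (hwit : ∀ j, j ≤ k → ∀ y ∈ Λ j, ∃ ut : Site d → 𝔸ˣ,
      InLambdaZ L (clampCfg (tlo L y j) (thi L y j) U₀) ut j α₃ (((L : ℝ) ^ j)⁻¹) ∧
      ∀ x : Site d, tlo L y j ≤ x → x ≤ thi L y j → u₁ x = ut x) :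
    Restr129Z L k Λ U₀ u₁⁻¹ ↔ Restr129Z L k Λ U₀ u₁ := by
  rw [restr129Z_iff_uavgZ, restr129Z_iff_uavgZ]
  refine forall_congr' fun j => forall_congr' fun hj => forall_congr' fun y => forall_congr' fun hy => ?_
  obtain ⟨ut, hW, hag⟩ := hwit j hj y hy
  have hy₀ : tlo L y 0 ≤ y := by rw [tlo_zero]
  have hy₀' : y ≤ thi L y 0 := by rw [thi_zero]
  rw [uavg_inv_tower_of_witness hLs hL1 hα₃ hα₃' hW hag (m := j) (n := 0) (by omega) y hy₀ hy₀', inv_eq_one]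

/-- **(1.29) FOR `u₁⁻¹` FROM (1.29) FOR `u₁`** (JOIN-B's binder `h129inv`, from the datum): witnesses at every `(j, y ∈ Λ_j)` suffice; no
global hypothesis. [cite: Balaban1985RegularSpaces, (1.29) p.81, (1.68) p.88] -/
theorem restr129_inv_of_witness (hLs : L = 2 * s + 1) (hL1 : 1 ≤ L) (hα₃ : 0 ≤ α₃) (hα₃' : α₃ < 1 / 2)
    (hwit : ∀ j, j ≤ k → ∀ y ∈ Λ j, ∃ ut : Site d → 𝔸ˣ,
      InLambdaZ L (clampCfg (tlo L y j) (thi L y j) U₀) ut j α₃ (((L : ℝ) ^ j)⁻¹) ∧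
      ∀ x : Site d, tlo L y j ≤ x → x ≤ thi L y j → u₁ x = ut x)
    (h129 : Restr129Z L k Λ U₀ u₁) : Restr129Z L k Λ U₀ u₁⁻¹ :=
  (restr129_inv_iff_of_witness hLs hL1 hα₃ hα₃' hwit).2 h129

end Restr

/-! ## §3 Proposition 10 (203)/(204) on the tower for any `u₁` with a `Λ_j`-witness -/

section Prop10

variable {𝔸 : Type*} [NormedRing 𝔸] [NormOneClass 𝔸] [NormedAlgebra ℂ 𝔸] [CompleteSpace 𝔸]
variable {L s : ℕ} {G : Subgroup 𝔸ˣ} {j : ℕ} {y : Site d} {U₀ : Site d → Fin d → 𝔸ˣ} {α₀ α₃ α₄ : ℝ} {lam : Site d → 𝔸}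
  {u₁ ut : Site d → 𝔸ˣ}

/-- (207) on the tower for `λ` ⇒ the global (176)/(177) for `e^{λ∘π}` w.r.t. the clamped background (constant `4α₄`, scale `L^{−j}`) — the
(207) ⇒ (176)/(177) step of [3] p. 50 (`B7Eq214.ineq176_of_207` / `ineq177_of_207`) for the extended data. [cite: Balaban1985Averaging, (207) p.50, (176)–(177) p.45] -/
private theorem h176_177_clamp (hL1 : 1 ≤ L) (hα₄ : 0 < α₄) (hα₄' : α₄ ≤ 1 / 4)
    (h177b : ∀ x : Site d, InBox (tlo L y j) (thi L y j) x → ‖lam x‖ < α₄)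
    (h177a : ∀ (x : Site d) (κ : Fin d), InBox (tlo L y j) (thi L y j) x → InBox (tlo L y j) (thi L y j) (x + e κ) →
      ‖cj (U₀ x κ) (lam (x + e κ)) - lam x‖ < α₄ * ((L : ℝ) ^ j)⁻¹) :
    SiteBd (fun x => expUnit (lam (clamp (tlo L y j) (thi L y j) x))) (4 * α₄) ∧
      CovBondBd (clampCfg (tlo L y j) (thi L y j) U₀) (fun x => expUnit (lam (clamp (tlo L y j) (thi L y j) x)))
        (4 * α₄ * ((L : ℝ) ^ j)⁻¹) := by
  have hlohi : ∀ i, tlo L y j i ≤ thi L y j i := tlo_le_thi L le_rfl j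
  have hLr : (1 : ℝ) ≤ L := by exact_mod_cast hL1
  have hη1 : ((L : ℝ) ^ j)⁻¹ ≤ 1 := inv_le_one_of_one_le₀ (one_le_pow₀ hLr)
  have hb : ∀ x : Site d, ‖lam (clamp (tlo L y j) (thi L y j) x)‖ < α₄ := fun x => h177b _ (clamp_inBox hlohi x)
  have ha : ∀ (x : Site d) (κ : Fin d), ‖cj (clampCfg (tlo L y j) (thi L y j) U₀ x κ) (lam (clamp (tlo L y j) (thi L y j) (x + e κ))) -
      lam (clamp (tlo L y j) (thi L y j) x)‖ < α₄ * ((L : ℝ) ^ j)⁻¹ := by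
    intro x κ
    by_cases hP : tlo L y j κ ≤ x κ ∧ x κ < thi L y j κ
    · have hx := clamp_inBox hlohi x
      have hxe : InBox (tlo L y j) (thi L y j) (clamp (tlo L y j) (thi L y j) x + e κ) := by
        rw [← clamp_add_e_of hP]; exact clamp_inBox hlohi _
      simp only [clampCfg, hP, and_self, if_true, clamp_add_e_of hP]
      exact h177a _ κ hx hxe
    · simp only [clampCfg, hP, if_false, clamp_add_e_of_not (hlohi κ) hP, cj_apply, Units.val_one, inv_one, one_mul, mul_one,
        sub_self, norm_zero]
      positivity
  refine ⟨fun x => ?_, fun x κ => ?_⟩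
  · show ‖((expUnit (lam (clamp (tlo L y j) (thi L y j) x)) : 𝔸ˣ) : 𝔸) - 1‖ ≤ 4 * α₄
    rw [val_expUnit]
    exact (B7Eq214.ineq176_of_207 _ hα₄' (hb x)).le
  · show ‖((((expUnit (lam (clamp (tlo L y j) (thi L y j) x)))⁻¹ *
        Rc (clampCfg (tlo L y j) (thi L y j) U₀ x κ) (expUnit (lam (clamp (tlo L y j) (thi L y j) (x + e κ)))) : 𝔸ˣ)) : 𝔸) - 1‖ ≤
      4 * α₄ * ((L : ℝ) ^ j)⁻¹
    rw [Units.val_mul, val_inv_expUnit, val_Rc_eq_cj, val_expUnit, val_expUnit, cj_apply]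
    exact (B7Eq214.ineq177_of_207 _ _ _ hα₄' hη1 (hb x) (ha x κ)).le

/-- **(203)/(204) OF [3] ON THE TOWER FOR ANY `u₁` WITH A `Λ_j`-WITNESS** (B8 pp. 89–90: «the assumptions of Proposition 10 … hold»): for
`u′ = e^{λ}` with (207) on `Bʲ(y)` (`‖λ(x)‖ < α₄`, `‖R(U₀(b))λ(b₊) − λ(b₋)‖ < α₄L^{−j}`), `u₁` agreeing on `Bʲ(y)` with a global
`ũ ∈ Λ_j(π^*U₀, α₃)`, `U₀` `G`-valued and regular on `Bʲ(y)` ((1.33)), and r04's Prop-10 windows at `(α₃, 4α₄)`: at every level-`m` site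
`z ∈ Bⁿ(y)` (`n + m = j`), (204) `‖ũ′ᵐ(z) − 1‖ ≤ C₆·(4α₄)`, and at every level-`m` bond `⟨z, z + e_κ⟩` inside `Bⁿ(y)`, (203)
`‖ũ′ᵐ(z)⁻¹R(Ū₀ᵐ(z, κ))ũ′ᵐ(z + e_κ) − 1‖ ≤ 2(4α₄)·Lᵐ·L^{−j}` (this seat's g0 `B8Eq178Local.prop10_local` with «`u₁ = glev_j`» replaced by the
witness). [cite: Balaban1985RegularSpaces, p.89, (1.77) p.90; Balaban1985Averaging, Proposition 10 (203)–(204) p.50, (207) p.50] -/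
theorem prop10_tower_of_witness (hLs : L = 2 * s + 1) (hs1 : 1 ≤ s) (hd : 1 ≤ d) (hG : AvgClosedZ d L G) (hU₀ : ∀ x κ, U₀ x κ ∈ G)
    (hα : 0 < α₀) (hα3 : C0Z d * α₀ ≤ 1 / 3) (hα4 : 4 * α₀ ≤ c2' d L)
    (h33 : pdevOn (tlo L y j) (thi L y j) U₀ < α₀ * (((L : ℝ) ^ j)⁻¹) ^ 2) (hL1 : 1 ≤ L)
    (hW : InLambdaZ L (clampCfg (tlo L y j) (thi L y j) U₀) ut j α₃ (((L : ℝ) ^ j)⁻¹))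
    (hu₁ : ∀ x : Site d, tlo L y j ≤ x → x ≤ thi L y j → u₁ x = ut x)
    (hα₄ : 0 < α₄) (h177b : ∀ x : Site d, InBox (tlo L y j) (thi L y j) x → ‖lam x‖ < α₄)
    (h177a : ∀ (x : Site d) (κ : Fin d), InBox (tlo L y j) (thi L y j) x → InBox (tlo L y j) (thi L y j) (x + e κ) →
      ‖cj (U₀ x κ) (lam (x + e κ)) - lam x‖ < α₄ * ((L : ℝ) ^ j)⁻¹)
    (hα₃ : 0 ≤ α₃) (hα₃' : α₃ ≤ 1 / 50)
    (hs₁ : 10 * C6 d * (4 * α₄) ≤ 1) (hs₂ : 3000 * ((d : ℝ) + 1) * L * (4 * α₄) ≤ 1) (hs₃ : C4G d L * (α₀ + α₃ + 4 * α₄) ≤ 1)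
    (hs₄ : 1024 * ((d : ℝ) + 1) * ((d : ℝ) + 4) * L ^ 2 * α₀ ≤ 1) (hs₅ : 32 * ((d : ℝ) + 1) ^ 2 * C6 d * L ^ 2 * α₀ ≤ 1)
    (hs₆ : 16 * d * C5' d * C6 d * (L : ℝ) ^ 2 * α₀ ≤ 1)
    {m n : ℕ} (hmn : n + m = j) :
    (∀ z : Site d, tlo L y n ≤ z → z ≤ thi L y n →
        ‖((utilGZ L U₀ (fun x => expUnit (lam x)) u₁ m z : 𝔸ˣ) : 𝔸) - 1‖ ≤ C6 d * (4 * α₄)) ∧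
      ∀ (z : Site d) (κ : Fin d), tlo L y n ≤ z → z + e κ ≤ thi L y n →
        ‖((((utilGZ L U₀ (fun x => expUnit (lam x)) u₁ m z)⁻¹
            * Rc (avgIterZ L U₀ m z κ) (utilGZ L U₀ (fun x => expUnit (lam x)) u₁ m (z + e κ)) : 𝔸ˣ)) : 𝔸) - 1‖
          ≤ 2 * (4 * α₄) * ((L : ℝ) ^ m * ((L : ℝ) ^ j)⁻¹) := by
  have hL : 2 ≤ L := by omega
  have hlohi : ∀ i, tlo L y j i ≤ thi L y j i := tlo_le_thi L le_rfl j
  have hUU : ∀ x κ, U₀ x κ ∈ U1 𝔸 := fun x κ => hG.le_U1 (hU₀ x κ)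
  have hLj : (0 : ℝ) < (L : ℝ) ^ j := by positivity
  have hC6 : (2 : ℝ) ≤ C6 d := by unfold C6; linarith [one_le_C5 (d := d)]
  have hα₄' : α₄ ≤ 1 / 4 := by nlinarith
  -- the extended data
  set U₀c := clampCfg (tlo L y j) (thi L y j) U₀ with hU₀c_def
  set lamc : Site d → 𝔸 := fun x => lam (clamp (tlo L y j) (thi L y j) x) with hlamc_def
  have hU₀c : ∀ x κ, U₀c x κ ∈ G := clampCfg_mem hU₀
  have h52c : pdev U₀c < α₀ * (((L : ℝ) ^ j)⁻¹) ^ 2 := (pdev_clampCfg_le hlohi hUU).trans_lt h33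
  have h₀ : AgreeOn (tlo L y j) (thi L y j) U₀ U₀c := (clampCfg_agree U₀).symm
  obtain ⟨h176, h177⟩ := h176_177_clamp (U₀ := U₀) (lam := lam) hL1 hα₄ hα₄' h177b h177a
  -- the GLOBAL (203)/(204) for the clamped data and the witness, `k ↦ j`
  have hP := prop10_generalZ_of52 hLs hs1 hd hG hU₀c hα hα3 hα4 h52c h176 h177 hW hα₃ hα₃' (by positivity) hs₁ hs₂ hs₃ hs₄ hs₅ hs₆ m
    (by omega)
  -- transfer to the original data on the tower
  have hu' : ∀ x : Site d, tlo L y j ≤ x → x ≤ thi L y j → (fun x => expUnit (lam x)) x = (fun x => expUnit (lamc x)) x :=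
    fun x hx hx' => by simp only [hlamc_def, clamp_of_inBox (inBox_of_le hx hx')]
  refine ⟨fun z hz hz' => ?_, fun z κ hz hz' => ?_⟩
  · rw [utilGZ_congr_tower hLs h₀ hu' hu₁ m n hmn z hz hz']
    exact hP.2 z
  · have hze : z ≤ thi L y n := fun i => by
      have := hz' i; rw [Pi.add_apply] at this
      have he : 0 ≤ e κ i := by rw [B7Prop1Explicit.e_apply]; split_ifs <;> norm_num
      linarith
    have hze' : tlo L y n ≤ z + e κ := fun i => by
      have := hz i; rw [Pi.add_apply]
      have he : 0 ≤ e κ i := by rw [B7Prop1Explicit.e_apply]; split_ifs <;> norm_num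
      linarith
    rw [utilGZ_congr_tower hLs h₀ hu' hu₁ m n hmn z hz hze, utilGZ_congr_tower hLs h₀ hu' hu₁ m n hmn (z + e κ) hze' hz',
      B8Ineq172ConcreteRec.avgIterZ_agree_tower hLs h₀ hmn z κ (inBox_of_le hz hze) (inBox_of_le hze' hz')]
    exact hP.1 z κ

/-- **`‖ũ′ᵐ(z) − 1‖ ≤ C₆·4α₄` ON THE TOWER FOR ANY `u₁` WITH A `Λ_j`-WITNESS** — (204) alone, in the `util178` currency of (1.78): with
`10·C₆·4α₄ ≤ 1` this is `< 1`, the log-domain condition under which (1.79) `Q′(u₁, λ) = 0` gives back (1.78) `ũ′ = 1`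
(`B8Eq178Averages.cond178_of_cond179`) — JOIN-B's `hdom`, here tower-local and for any `u₁` with a witness (e.g. `u₁⁻¹`).
[cite: Balaban1985RegularSpaces, (1.78)–(1.79) p.90; Balaban1985Averaging, (204) p.50] -/
theorem dom178_tower_of_witness (hLs : L = 2 * s + 1) (hs1 : 1 ≤ s) (hd : 1 ≤ d) (hG : AvgClosedZ d L G) (hU₀ : ∀ x κ, U₀ x κ ∈ G)
    (hα : 0 < α₀) (hα3 : C0Z d * α₀ ≤ 1 / 3) (hα4 : 4 * α₀ ≤ c2' d L)
    (h33 : pdevOn (tlo L y j) (thi L y j) U₀ < α₀ * (((L : ℝ) ^ j)⁻¹) ^ 2) (hL1 : 1 ≤ L)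
    (hW : InLambdaZ L (clampCfg (tlo L y j) (thi L y j) U₀) ut j α₃ (((L : ℝ) ^ j)⁻¹))
    (hu₁ : ∀ x : Site d, tlo L y j ≤ x → x ≤ thi L y j → u₁ x = ut x)
    (hα₄ : 0 < α₄) (h177b : ∀ x : Site d, InBox (tlo L y j) (thi L y j) x → ‖lam x‖ < α₄)
    (h177a : ∀ (x : Site d) (κ : Fin d), InBox (tlo L y j) (thi L y j) x → InBox (tlo L y j) (thi L y j) (x + e κ) →
      ‖cj (U₀ x κ) (lam (x + e κ)) - lam x‖ < α₄ * ((L : ℝ) ^ j)⁻¹)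
    (hα₃ : 0 ≤ α₃) (hα₃' : α₃ ≤ 1 / 50)
    (hs₁ : 10 * C6 d * (4 * α₄) ≤ 1) (hs₂ : 3000 * ((d : ℝ) + 1) * L * (4 * α₄) ≤ 1) (hs₃ : C4G d L * (α₀ + α₃ + 4 * α₄) ≤ 1)
    (hs₄ : 1024 * ((d : ℝ) + 1) * ((d : ℝ) + 4) * L ^ 2 * α₀ ≤ 1) (hs₅ : 32 * ((d : ℝ) + 1) ^ 2 * C6 d * L ^ 2 * α₀ ≤ 1)
    (hs₆ : 16 * d * C5' d * C6 d * (L : ℝ) ^ 2 * α₀ ≤ 1)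
    {m n : ℕ} (hmn : n + m = j) (z : Site d) (hz : tlo L y n ≤ z) (hz' : z ≤ thi L y n) :
    ‖util178Z L U₀ (fun x => expUnit (lam x)) u₁ m z - 1‖ ≤ C6 d * (4 * α₄) := by
  rw [util178Z_eq_utilGZ]
  exact (prop10_tower_of_witness hLs hs1 hd hG hU₀ hα hα3 hα4 h33 hL1 hW hu₁ hα₄ h177b h177a hα₃ hα₃' hs₁ hs₂ hs₃ hs₄ hs₅ hs₆ hmn).1 z
    hz hz'

end Prop10

/-! ## §4 A `Λ_j`-witness for the product `e^{λ}·u₁` -/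

section Mul

variable {𝔸 : Type*} [NormedRing 𝔸] [NormOneClass 𝔸] [NormedAlgebra ℂ 𝔸] [CompleteSpace 𝔸]
variable {L s : ℕ} {G : Subgroup 𝔸ˣ} {j : ℕ} {y : Site d} {U₀ : Site d → Fin d → 𝔸ˣ} {α₀ α₃ α₄ : ℝ} {lam : Site d → 𝔸}
  {u₁ ut : Site d → 𝔸ˣ}

/-- **A `Λ_j`-WITNESS FOR THE PRODUCT `e^{λ}·u₁`** ([3] p. 45 «if u′ is such a configuration and u₁ belongs to a class Λ_k(α₃), then the
product u′u₁ belongs to some class Λ_k(O(1)(α₃ + α₄))», r04 `B7Prop10InLambda.inLambda_mul_of_prop10_general`), tower-local: from a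
witness `ũ` for `u₁` at `(j, y)` (constant `α₃`) and (207) for `λ` on `Bʲ(y)`, the global product `e^{λ∘π}·ũ` lies in
`Λ_j(π^*U₀, 2C₆(α₃ + 4α₄))` and agrees with `e^{λ}·u₁` on `Bʲ(y)`.  Windows: r04's Prop-10 windows at `(α₃, 4α₄)` + Prop. 2's for the clamped
background. [cite: Balaban1985Averaging, p.45 (after (177)), Proposition 10 p.50, (178) p.45] -/
theorem witness_mul_of207 (hLs : L = 2 * s + 1) (hs1 : 1 ≤ s) (hd : 1 ≤ d) (hG : AvgClosedZ d L G) (hU₀ : ∀ x κ, U₀ x κ ∈ G)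
    (hα : 0 < α₀) (hα3 : C0Z d * α₀ ≤ 1 / 3) (hα4 : 4 * α₀ ≤ c2' d L)
    (h33 : pdevOn (tlo L y j) (thi L y j) U₀ < α₀ * (((L : ℝ) ^ j)⁻¹) ^ 2) (hL1 : 1 ≤ L)
    (hW : InLambdaZ L (clampCfg (tlo L y j) (thi L y j) U₀) ut j α₃ (((L : ℝ) ^ j)⁻¹))
    (hu₁ : ∀ x : Site d, tlo L y j ≤ x → x ≤ thi L y j → u₁ x = ut x)
    (hα₄ : 0 < α₄) (h177b : ∀ x : Site d, InBox (tlo L y j) (thi L y j) x → ‖lam x‖ < α₄)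
    (h177a : ∀ (x : Site d) (κ : Fin d), InBox (tlo L y j) (thi L y j) x → InBox (tlo L y j) (thi L y j) (x + e κ) →
      ‖cj (U₀ x κ) (lam (x + e κ)) - lam x‖ < α₄ * ((L : ℝ) ^ j)⁻¹)
    (hα₃ : 0 ≤ α₃) (hα₃' : α₃ ≤ 1 / 50)
    (hs₁ : 10 * C6 d * (4 * α₄) ≤ 1) (hs₂ : 3000 * ((d : ℝ) + 1) * L * (4 * α₄) ≤ 1) (hs₃ : C4G d L * (α₀ + α₃ + 4 * α₄) ≤ 1)
    (hs₄ : 1024 * ((d : ℝ) + 1) * ((d : ℝ) + 4) * L ^ 2 * α₀ ≤ 1) (hs₅ : 32 * ((d : ℝ) + 1) ^ 2 * C6 d * L ^ 2 * α₀ ≤ 1)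
    (hs₆ : 16 * d * C5' d * C6 d * (L : ℝ) ^ 2 * α₀ ≤ 1) :
    ∃ wt : Site d → 𝔸ˣ, InLambdaZ L (clampCfg (tlo L y j) (thi L y j) U₀) wt j (2 * C6 d * (α₃ + 4 * α₄)) (((L : ℝ) ^ j)⁻¹) ∧
      ∀ x : Site d, tlo L y j ≤ x → x ≤ thi L y j → ((fun x => expUnit (lam x)) * u₁) x = wt x := by
  have hL : 2 ≤ L := by omega
  have hlohi : ∀ i, tlo L y j i ≤ thi L y j i := tlo_le_thi L le_rfl j
  have hUU : ∀ x κ, U₀ x κ ∈ U1 𝔸 := fun x κ => hG.le_U1 (hU₀ x κ)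
  have hLr : (1 : ℝ) ≤ L := by exact_mod_cast hL1
  have hLj : (0 : ℝ) < (L : ℝ) ^ j := by positivity
  have hC6 : (2 : ℝ) ≤ C6 d := by unfold C6; linarith [one_le_C5 (d := d)]
  have hα₄' : α₄ ≤ 1 / 4 := by nlinarith
  set U₀c := clampCfg (tlo L y j) (thi L y j) U₀ with hU₀c_def
  have hU₀c : ∀ x κ, U₀c x κ ∈ G := clampCfg_mem hU₀
  have h52c : pdev U₀c < α₀ * (((L : ℝ) ^ j)⁻¹) ^ 2 := (pdev_clampCfg_le hlohi hUU).trans_lt h33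
  obtain ⟨h176, h177⟩ := h176_177_clamp (U₀ := U₀) (lam := lam) hL1 hα₄ hα₄' h177b h177a
  obtain ⟨hV, hPl⟩ := levels_of52Z hL hG hU₀c j hα hα3 hα4 h52c
  have hη : (0 : ℝ) ≤ ((L : ℝ) ^ j)⁻¹ := by positivity
  have hk : (L : ℝ) ^ j * ((L : ℝ) ^ j)⁻¹ ≤ 1 := by rw [mul_inv_cancel₀ hLj.ne']
  have hΛ := inLambdaZ_mul_of_prop10_generalZ hLs hs1 hd (fun i hi => hV i hi.le) (fun i hi => hPl i hi.le) h176 h177 hW hη hk hα.le hα₃ hα₃'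
    (by positivity) hs₁ hs₂ hs₃ hs₄ hs₅ hs₆
  refine ⟨_, hΛ, fun x hx hx' => ?_⟩
  rw [Pi.mul_apply, Pi.mul_apply, hu₁ x hx hx', clamp_of_inBox (inBox_of_le hx hx')]

end Mul

/-! ## §5 The driver's (1.29)-clause by the LOCAL inversion route -/

section Driver

variable {𝔸 : Type*} [CStarAlgebra 𝔸] [Nontrivial 𝔸]
variable {L s k : ℕ} {Λ : ℕ → Set (Site d)} {U₀ : Site d → Fin d → 𝔸ˣ} {α₀ α₃ α₄ : ℝ} {lam : Site d → 𝔸} {u₁ : Site d → 𝔸ˣ}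

/-- **THE THEOREM-4 DRIVER'S (1.29)-CLAUSE BY INVERSION, TOWER-LOCAL HYPOTHESES ONLY** (route (a″) of the knit, `pub-ymgap-dag-n05-a` ruling;
this seat's g2 `restr129_mul_gaugeExp_of_cond179_neg` without its GLOBAL (167)/`hdom` binders and without `Restr129 … u₁⁻¹`): let `u₁` satisfy
(1.29) at `k` levels (`Restr129`) and have at every `(j, y ∈ Λ_j)` a UNITARY `Λ_j`-witness (constant `α₃`; e.g. `witness_unitary_of_glev` /
`witness_of_axial` for Theorem 4's inductive `u₁`), `U₀` unitary-valued with (1.33) on the towers, `λ` with (207) on the towers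
(`‖λ‖ < α₄`, covariant differences `< α₄L^{−j}`), and suppose Sect. E's output for the INVERSE pair: «`Q′(u₁⁻¹, λ) = 0` on `𝔅_k`»
(`Cond179Z L k Λ U₀ e^{λ} u₁⁻¹`).  THEN `u₁·(e^{λ})⁻¹` satisfies (1.29) at `k` levels.  PROOF at a constraint site `y ∈ Λ_j`: the product
`w = e^{λ}u₁⁻¹` has the witness of §4 built on `ũ⁻¹` (`witness_inv_of_unitary`), so `\overline{R₀(u₁e^{−λ})}ʲ(y) = \overline{R₀w⁻¹}ʲ(y) =
(\overline{R₀w}ʲ(y))⁻¹` (§1); `\overline{R₀w}ʲ = ũ′ʲ·\overline{R₀u₁⁻¹}ʲ` ((178)); `\overline{R₀u₁⁻¹}ʲ(y) = (\overline{R₀u₁}ʲ(y))⁻¹ = 1` (§1, (1.29));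
`ũ′ʲ(y) = 1` by (1.79) ⇒ (1.78) on the log domain (§3, `‖ũ′ʲ(y) − 1‖ ≤ 4C₆α₄ < 1`).  With `λ := −iλ′` the conclusion reads
`Restr129 … (u₁ * e^{iλ′})`, HFP's last clause. [cite: Balaban1985RegularSpaces, (1.29) p.81, (1.78)–(1.79) p.90, p.94 («u = u′u₁»), (1.112) p.95; Balaban1985Averaging, (178) p.45, Prop. 10 (204) p.50] -/
theorem restr129_mul_inv_of_cond179_local (hLs : L = 2 * s + 1) (hs1 : 1 ≤ s) (hd : 1 ≤ d) (hL1 : 1 ≤ L)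
    (hU₀ : ∀ x κ, U₀ x κ ∈ unitaryUnits 𝔸)
    (hα : 0 < α₀) (hα3 : C0Z d * α₀ ≤ 1 / 3) (hα4 : 4 * α₀ ≤ c2' d L) (hα₃ : 0 ≤ α₃) (hα₃' : α₃ ≤ 1 / 50) (hα₄ : 0 < α₄)
    (h33 : ∀ j, j ≤ k → ∀ y ∈ Λ j, pdevOn (tlo L y j) (thi L y j) U₀ < α₀ * (((L : ℝ) ^ j)⁻¹) ^ 2)
    (hwit : ∀ j, j ≤ k → ∀ y ∈ Λ j, ∃ ut : Site d → 𝔸ˣ, (∀ x, ut x ∈ unitaryUnits 𝔸) ∧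
      InLambdaZ L (clampCfg (tlo L y j) (thi L y j) U₀) ut j α₃ (((L : ℝ) ^ j)⁻¹) ∧
      ∀ x : Site d, tlo L y j ≤ x → x ≤ thi L y j → u₁ x = ut x)
    (h177b : ∀ j, j ≤ k → ∀ y ∈ Λ j, ∀ x : Site d, InBox (tlo L y j) (thi L y j) x → ‖lam x‖ < α₄)
    (h177a : ∀ j, j ≤ k → ∀ y ∈ Λ j, ∀ (x : Site d) (κ : Fin d), InBox (tlo L y j) (thi L y j) x →
      InBox (tlo L y j) (thi L y j) (x + e κ) → ‖cj (U₀ x κ) (lam (x + e κ)) - lam x‖ < α₄ * ((L : ℝ) ^ j)⁻¹)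
    (hs₁ : 10 * C6 d * (4 * α₄) ≤ 1) (hs₂ : 3000 * ((d : ℝ) + 1) * L * (4 * α₄) ≤ 1) (hs₃ : C4G d L * (α₀ + α₃ + 4 * α₄) ≤ 1)
    (hs₄ : 1024 * ((d : ℝ) + 1) * ((d : ℝ) + 4) * L ^ 2 * α₀ ≤ 1) (hs₅ : 32 * ((d : ℝ) + 1) ^ 2 * C6 d * L ^ 2 * α₀ ≤ 1)
    (hs₆ : 16 * d * C5' d * C6 d * (L : ℝ) ^ 2 * α₀ ≤ 1)
    (hprod : 2 * C6 d * (α₃ + 4 * α₄) < 1 / 2)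
    (h129 : Restr129Z L k Λ U₀ u₁) (h179 : Cond179Z L k Λ U₀ (fun x => expUnit (lam x)) u₁⁻¹) :
    Restr129Z L k Λ U₀ (u₁ * (fun x => expUnit (lam x))⁻¹) := by
  have hG := avgClosedZ_unitaryUnits d L (𝔸 := 𝔸)
  have hL : 2 ≤ L := by omega
  have hC6 : (2 : ℝ) ≤ C6 d := by unfold C6; linarith [one_le_C5 (d := d)]
  have hα₃h : α₃ < 1 / 2 := by linarith
  have hα₃q : α₃ ≤ 1 / 4 := by linarith
  rw [restr129Z_iff_uavgZ]
  intro j hj y hy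
  obtain ⟨ut, hun, hW, hag⟩ := hwit j hj y hy
  have hy₀ : tlo L y 0 ≤ y := by rw [tlo_zero]
  have hy₀' : y ≤ thi L y 0 := by rw [thi_zero]
  -- the witness `ũ⁻¹` for `u₁⁻¹` and the witness of §4 for the product `w = e^{λ}·u₁⁻¹`
  obtain ⟨uti, hWi, hagi⟩ := witness_inv_of_unitaryZ hLs hs1 hU₀ hα hα3 (by linarith) (h33 j hj y hy) hL1 hα₃ hα₃q hun hW hag
  obtain ⟨wt, hWw, hagw⟩ := witness_mul_of207 hLs hs1 hd hG hU₀ hα hα3 hα4 (h33 j hj y hy) hL1 hWi hagi hα₄ (h177b j hj y hy) (h177a j hj y hy)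
    hα₃ hα₃' hs₁ hs₂ hs₃ hs₄ hs₅ hs₆
  -- `u₁·(e^{λ})⁻¹ = w⁻¹`
  have hinv : u₁ * (fun x => expUnit (lam x))⁻¹ = ((fun x => expUnit (lam x)) * u₁⁻¹)⁻¹ := by
    rw [mul_inv_rev, inv_inv]
  -- §1 twice: `\overline{R₀w⁻¹}ʲ(y) = (\overline{R₀w}ʲ(y))⁻¹`, `\overline{R₀u₁⁻¹}ʲ(y) = (\overline{R₀u₁}ʲ(y))⁻¹ = 1`
  have h1 := uavg_inv_tower_of_witness (u := (fun x => expUnit (lam x)) * u₁⁻¹) hLs hL1 (by positivity) hprod hWw hagw (m := j) (n := 0)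
    (by omega) y hy₀ hy₀'
  have h2 := uavg_inv_tower_of_witness (u := u₁) hLs hL1 hα₃ hα₃h hW hag (m := j) (n := 0) (by omega) y hy₀ hy₀'
  have h129y : uavgZ L U₀ u₁ j y = 1 := (restr129Z_iff_uavgZ L k Λ U₀ u₁).1 h129 j hj y hy
  -- (204) on the tower for `u₁⁻¹` ⇒ the log domain; (1.79) ⇒ (1.78): `ũ′ʲ(y) = 1`
  have hdom : ‖util178Z L U₀ (fun x => expUnit (lam x)) u₁⁻¹ j y - 1‖ < 1 := by
    have h := dom178_tower_of_witness hLs hs1 hd hG hU₀ hα hα3 hα4 (h33 j hj y hy) hL1 hWi hagi hα₄ (h177b j hj y hy) (h177a j hj y hy) hα₃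
      hα₃' hs₁ hs₂ hs₃ hs₄ hs₅ hs₆ (m := j) (n := 0) (by omega) y hy₀ hy₀'
    have : C6 d * (4 * α₄) ≤ 1 / 10 := by nlinarith
    linarith
  have h178 : util178Z L U₀ (fun x => expUnit (lam x)) u₁⁻¹ j y = 1 := by
    have h0 : mlog (util178Z L U₀ (fun x => expUnit (lam x)) u₁⁻¹ j y) = 0 := h179 j hj y hy
    rw [← exp_mlog hdom, h0, exp_zero]
  have hutil : utilGZ L U₀ (fun x => expUnit (lam x)) u₁⁻¹ j y = 1 := by
    rw [util178Z_eq_utilGZ, Units.val_eq_one] at h178; exact h178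
  -- assemble: `\overline{R₀w}ʲ(y) = ũ′ʲ(y)·\overline{R₀u₁⁻¹}ʲ(y) = 1·1`
  have hw : uavgZ L U₀ ((fun x => expUnit (lam x)) * u₁⁻¹) j y = 1 := by
    have h := congrFun (utilGZ_eq_uavgZ_mul_inv L U₀ (fun x => expUnit (lam x)) u₁⁻¹ j) y
    rw [hutil, h2, h129y, inv_one] at h
    simp only [inv_one, mul_one] at h
    exact h.symm
  rw [hinv, h1, hw, inv_one]

end Driver

end Literature.MathematicalPhysics.QuantumFieldTheory.Balaban1983to89.B8Restr129InversionLocalRec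

end
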